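import Mathlib
import Literature.Geometry.DiscreteGeometry.TwoShellPatterns
import Literature.Probability.Process.RootedHardCoreConfig
import Summits.AtomisticToContinuum.Crystallization.Theorems.GappedShellCensusCleanLimitsHaveWindowsCleanChartTransfer
import Summits.AtomisticToContinuum.Crystallization.Theorems.GappedShellCensusCleanLimitsHaveWindowsCleanChartGrowth
import Summits.AtomisticToContinuum.Crystallization.Theorems.GappedShellCensusCleanLimitsHaveWindowsCleanChartTGlobalG
import Summits.AtomisticToContinuum.Crystallization.Theorems.PalmUnimodularRigidityShellsToBarlowChartLocalCharts
import Summits.AtomisticToContinuum.Crystallization.Theorems.PalmUnimodularRigidityShellsToBarlowChartCubicGrowthAngle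
import Summits.AtomisticToContinuum.Crystallization.Theorems.ReggeStarCoercivityDefectFreeCrystallizesFunnelChart
import Summits.AtomisticToContinuum.Crystallization.Theorems.OverbindingBudgetTwoShellShape
import Summits.AtomisticToContinuum.Crystallization.Theorems.OverbindingBudgetElasticSplitDoorBridge

/-!
# Barlow gluing at tolerance `1/16` — part I: the frame

Route `OverbindingBudget` (stmt-AtomisticToContinuum-31280), cell `decomp-a2c`, lens 3 (certified translation +
split beneath).  Target: slot 5 of the cut of record (cone XL,
`OverbindingBudgetGrossMargin.rdef_fortieth_of_recordK_gross_ref`), the gluing statement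

  `BarlowGluingW : ∀ Y, 0 ∈ Y → UniformlyDiscrete Y → (∀ q ∈ Y, IsTwoShellGoodSet (1/16) (9/10) (103/100) Y q) → IsCharted (μS Y)`

(`OverbindingBudgetTwoShellShape`): a uniformly discrete configuration through the origin, every atom of which sees —
up to `a/16` at its own scale `a ∈ [9/10, 103/100]` — exactly the first two coordination shells of the FCC or of the HCP
pattern, is Barlow-bond-charted (a bond-faithful bijection from an ideal Barlow stacking, bond window `(0, 28/25]`).

**The translation.**  `IsCharted (μS Y)` is literally the conclusion shape of the tree's SHELLS-TO-BARLOW-CHART machine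
(route `PalmUnimodularRigidity`, crux `ShellsToBarlowChart`, and its `CleanHull` re-run): a TRANSPORT SYSTEM on `Y`
(`PalmUnimodularRigidityShellsToBarlowChart.TransportSystem`) plus eventual cubic growth of the window-graph balls give the
Barlow chart (`PalmGoodLaw.FunnelChart.barlowChart_of_transportSystem`), and a transport system is assembled from a
CHART BUNDLE — per-site integer charts `nb z : Pc z → Y` (`Pc z ∈ {fcc3Int, hcpInt}`) that are bijective onto the bond
star, bond-faithful, and TRANSFER along bonds — on a connected window graph (`Clean.transportSystem_of_connected`).
All three interfaces are purely combinatorial (bond window `(0, 28/25]`, integer labels), so the generous metric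
tolerance `a/16` and the site-dependent scales of `BarlowGluingW` are admissible: this file records the frame

  `isCharted_μS_of_chartBundle : 0 ∈ Y → chart bundle → connected → cubic growth → IsCharted (μS Y)`,
  `barlowGluingW_of_charts : (∀ Y, … → ∃ Pc nb, bundle ∧ connected ∧ growth) → BarlowGluingW`;

part II (`ChartedPlanarOrderBarlowGluingCharts`) builds the integer charts from two-shell goodness (common comparison
scale `193/200`, transfer by `CleanHull.transfer_of_close`), part III (`ChartedPlanarOrderBarlowGluing`) proves
connectivity and cubic growth (two-step local walks below `27/20`, greedy descent with gain `1/12` above it) and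
concludes `barlowGluingW_holds : BarlowGluingW`.  The imports of the whole development are fixed here once.

References: Hales, *Dense Sphere Packings — a blueprint for formal proofs* (2012) §1.3 (pp. 16–18: «all packings in
which every tangent arrangement is the FCC or the HCP pattern are the Barlow packings»); Conway–Sloane, *SPLAG*;
the tree files named above.
-/

noncomputable section

namespace Summit.AtomisticToContinuum.Crystallization.Theorems.ChartedPlanarOrderBarlowGluingFrame

open Literature.MathematicalPhysics.StatisticalMechanics (UniformlyDiscrete)
open Literature.Geometry.DiscreteGeometry
open Summit.AtomisticToContinuum.Crystallization.Theorems.PalmUnimodularRigidityShellsToBarlowChart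
open Summit.AtomisticToContinuum.Crystallization.Theorems.OverbindingBudgetTwoShellShape (BarlowGluingW)
open Summit.AtomisticToContinuum.Crystallization.Theorems.ChartedPlanarOrderRigidityDoor (IsCharted)
open Summit.AtomisticToContinuum.Crystallization.Theorems.ChartedPlanarOrderDensityDichotomy (μS)
open Summit.AtomisticToContinuum.Crystallization.Theorems.OverbindingBudgetElasticSplitDoorBridge (setOf_μS_singleton_ne_zero)
open MeasureTheory Metric

local notation "E3" => EuclideanSpace ℝ (Fin 3)

/-- **The frame.**  A configuration `Y ∋ 0` carrying a chart bundle (per-site integer charts of FCC/HCP type, bijective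
onto the bond stars, bond-faithful, transferring along bonds — the hypothesis bundle of
`Clean.transportSystem_of_connected`, verbatim) on a connected window graph with eventually-cubic ball growth is
Barlow-bond-charted: `IsCharted (μS Y)`. [tree: `Clean.transportSystem_of_connected`,
`PalmGoodLaw.FunnelChart.barlowChart_of_transportSystem`, `setOf_μS_singleton_ne_zero`] -/
theorem isCharted_μS_of_chartBundle {Y : Set E3} {Pc : E3 → Finset (Fin 3 → ℤ)} {nb : E3 → (Fin 3 → ℤ) → E3}
    (h0 : (0 : E3) ∈ Y)
    (hch : ((∀ z ∈ Y, (Pc z = fcc3Int ∨ Pc z = hcpInt) ∧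
        Set.BijOn (nb z) (↑(Pc z) : Set (Fin 3 → ℤ)) {y | y ∈ Y ∧ (0 < dist z y ∧ dist z y ≤ 28 / 25)} ∧
        (∀ t ∈ Pc z, ∀ t' ∈ Pc z, ((0 < dist (nb z t) (nb z t') ∧ dist (nb z t) (nb z t') ≤ 28 / 25) ↔
          sqNormInt (t - t') = 18))) ∧
      (∀ x ∈ Y, ∀ y ∈ Y, (0 < dist x y ∧ dist x y ≤ 28 / 25) → ∀ t ∈ Pc x, ∀ t' ∈ Pc x, ∀ u ∈ Pc y, ∀ u' ∈ Pc y,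
        nb y u = nb x t → nb y u' = nb x t' → sqNormInt (u - u') = sqNormInt (t - t'))))
    (hconn : ∀ x ∈ Y, ∀ y ∈ Y, Nonempty ((windowGraph Y).Walk x y))
    (hgrowth : ∀ x ∈ Y, ∃ C : ℝ, 0 < C ∧ ∃ n₀ : ℕ, ∀ n : ℕ, n₀ ≤ n →
      C * (n : ℝ) ^ 3 ≤ (Set.ncard (windowBall Y x n) : ℝ)) :
    IsCharted (μS Y) := by
  have hT : TransportSystem Y := Clean.transportSystem_of_connected ⟨0, h0⟩ hch hconn
  obtain ⟨s, hs, Ψ, hbij, hiso⟩ := PalmGoodLaw.FunnelChart.barlowChart_of_transportSystem hT hgrowth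
  have hset : {p : E3 | μS Y {p} ≠ 0} = Y := setOf_μS_singleton_ne_zero Y
  refine ⟨s, hs, Ψ, ?_, fun p hp q hq => ?_⟩
  · rw [hset]
    exact hbij
  · have h := hiso p hp q hq
    rw [IsBond] at h
    exact h

/-- **The reduction of slot 5 to charts, walks and growth.**  If every configuration in the scope of `BarlowGluingW`
carries a chart bundle on a connected window graph with eventually-cubic growth, then `BarlowGluingW`. [this file] -/
theorem barlowGluingW_of_charts
    (H : ∀ Y : Set E3, (0 : E3) ∈ Y → UniformlyDiscrete Y →
      (∀ q ∈ Y, IsTwoShellGoodSet (1 / 16) (9 / 10) (103 / 100) Y q) →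
      ∃ (Pc : E3 → Finset (Fin 3 → ℤ)) (nb : E3 → (Fin 3 → ℤ) → E3),
        ((∀ z ∈ Y, (Pc z = fcc3Int ∨ Pc z = hcpInt) ∧
            Set.BijOn (nb z) (↑(Pc z) : Set (Fin 3 → ℤ)) {y | y ∈ Y ∧ (0 < dist z y ∧ dist z y ≤ 28 / 25)} ∧
            (∀ t ∈ Pc z, ∀ t' ∈ Pc z, ((0 < dist (nb z t) (nb z t') ∧ dist (nb z t) (nb z t') ≤ 28 / 25) ↔
              sqNormInt (t - t') = 18))) ∧
          (∀ x ∈ Y, ∀ y ∈ Y, (0 < dist x y ∧ dist x y ≤ 28 / 25) → ∀ t ∈ Pc x, ∀ t' ∈ Pc x, ∀ u ∈ Pc y, ∀ u' ∈ Pc y,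
            nb y u = nb x t → nb y u' = nb x t' → sqNormInt (u - u') = sqNormInt (t - t'))) ∧
        (∀ x ∈ Y, ∀ y ∈ Y, Nonempty ((windowGraph Y).Walk x y)) ∧
        (∀ x ∈ Y, ∃ C : ℝ, 0 < C ∧ ∃ n₀ : ℕ, ∀ n : ℕ, n₀ ≤ n → C * (n : ℝ) ^ 3 ≤ (Set.ncard (windowBall Y x n) : ℝ))) :
    BarlowGluingW := by
  intro Y h0 hud hgood
  obtain ⟨Pc, nb, hch, hconn, hgrowth⟩ := H Y h0 hud hgood
  exact isCharted_μS_of_chartBundle h0 hch hconn hgrowth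

end Summit.AtomisticToContinuum.Crystallization.Theorems.ChartedPlanarOrderBarlowGluingFrame
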